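import Literature.Topology.FourManifolds.LatticeFormsProofs
import HarnessLib

/-!
# Kosinski's intersection matrix `Γ₈` of Milnor's plumbing `M(4n)` is a Gram matrix of `E₈`

Topic `Literature/Topology/FourManifolds`; the algebraic bridge used by the named fact
`Literature.Topology.FourManifolds.HomotopySphere.exists_intersectionForm_equivalent_e8Form`
(`HomotopySpheresBPOrderSignatureLeaves.lean`), whose docstring renders Kosinski's sentence
"a `4n`-dimensional handlebody `M(4n)` with the intersection matrix `Γ₈`" (A. Kosinski,
*Differential Manifolds* (1993), VI.12, p. 122) as "intersection form isometric to
`Literature.Topology.FourManifolds.e8Form`" (Gram matrix Mathlib's `CartanMatrix.E₈`, Bourbaki's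
numbering, `-1` off the diagonal), on the grounds that the two matrices "are Gram matrices of one
lattice in two bases (renumber, and change the signs of the basis vectors in one class of the
bipartition of the tree)". This file **proves** that claim:

* `kosinskiGamma8` — the printed `Γ₈`: `2` on the diagonal (VI.(12.4): `[Σ : Σ] = φ_*(τ₂ₙ) = 2`),
  `1` between adjacent vertices of the `E₈` tree numbered along its long path `Σ₁, …, Σ₇` with
  `Σ₈` joined to `Σ₅`, `0` elsewhere;
* `kosinskiGamma8ToE₈` — the signed permutation matrix `P` of the base change;
* `transpose_kosinskiGamma8ToE₈_mul_E₈_mul` — `Pᵀ E₈ P = Γ₈` (by `decide`);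
* `equivalent_toBilin'_kosinskiGamma8_e8Form` — `(Γ₈).Equivalent e8Form`
  (`LinearMap.BilinForm.Equivalent`, Mathlib), whence
* `signature_toBilin'_kosinskiGamma8` — "A calculation shows that the quadratic form over the
  reals with the matrix `Γ₈` has signature `8`" (loc. cit.), from the tree theorem
  `signature_e8Form_holds` (`LatticeFormsProofs.lean`), and `isUnimodular_toBilin'_kosinskiGamma8`
  — "Since `Γ₈` is unimodular, `∂M(4n)` is a homotopy sphere" (loc. cit.; the unimodularity only),
  from `isUnimodular_e8Form_holds`, and evenness.

Nothing geometric is claimed here: the plumbing theorem itself (VI.12 with (12.2) and IX.(7.5))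
remains the named fact above. No new named facts (D-0026).

## References

* A. Kosinski, *Differential Manifolds*, Academic Press 1993 (Dover 2007): VI.12,
  pp. 118–123 (`M(4n)`, `Γ₈` on p. 122, (12.2), (12.4)). [Kosinski1993]
* J. Milnor, D. Husemoller, *Symmetric bilinear forms* (1973), II §6 (`E₈`). [MilnorHusemoller1973]
-/

noncomputable section

namespace Literature.Topology.FourManifolds

open LinearMap.BilinForm
open scoped Matrix

/-- **Kosinski's `Γ₈`**, the intersection matrix of the `(4n, 2n)`-handlebody `M(4n)` obtained by
plumbing eight copies of the tangent disc bundle of `S²ⁿ` along the `E₈` tree (A. Kosinski,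
*Differential Manifolds* (1993), VI.12, p. 122): the symmetric integer matrix with `2` on the
diagonal (`[Σᵢ : Σᵢ] = φ_*(τ₂ₙ) = 2`, VI.(12.4)), `1` in position `(i, j)` when the presentation
spheres `Σᵢ`, `Σⱼ` correspond to adjacent vertices of the tree — numbered along the long path
`Σ₁ – Σ₂ – ⋯ – Σ₇` with the eighth vertex `Σ₈` joined to `Σ₅` — and `0` otherwise (the
off-diagonal intersection numbers are `±1`, VI.12 p. 121; printed as `+1`).
[cite: Kosinski1993, VI.12, p. 122 (the matrix Γ₈)] -/
def kosinskiGamma8 : Matrix (Fin 8) (Fin 8) ℤ :=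
  !![2, 1, 0, 0, 0, 0, 0, 0;
     1, 2, 1, 0, 0, 0, 0, 0;
     0, 1, 2, 1, 0, 0, 0, 0;
     0, 0, 1, 2, 1, 0, 0, 0;
     0, 0, 0, 1, 2, 1, 0, 1;
     0, 0, 0, 0, 1, 2, 1, 0;
     0, 0, 0, 0, 0, 1, 2, 0;
     0, 0, 0, 0, 1, 0, 0, 2]

/-- The base change from Kosinski's presentation spheres `Σ₁, …, Σ₈` of `M(4n)` (columns) to
Bourbaki's simple roots `α₁, …, α₈` of `E₈` as numbered in Mathlib's `CartanMatrix.E₈` (rows): a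
signed permutation matrix `P` — reverse the long path (`Σ₇, Σ₆, Σ₅, Σ₄, Σ₃, Σ₂, Σ₁ ↦
α₁, α₃, α₄, α₅, α₆, α₇, α₈`, and `Σ₈ ↦ α₂`, matching the branch vertices `Σ₅ ↔ α₄`) and change
the sign of the basis vectors in one class `{α₂, α₃, α₅, α₇}` of the bipartition of the tree, which
turns Bourbaki's `-1` off the diagonal into Kosinski's `+1`. [folklore] -/
def kosinskiGamma8ToE₈ : Matrix (Fin 8) (Fin 8) ℤ :=
  !![0, 0, 0, 0, 0, 0, 1, 0;
     0, 0, 0, 0, 0, 0, 0, -1;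
     0, 0, 0, 0, 0, -1, 0, 0;
     0, 0, 0, 0, 1, 0, 0, 0;
     0, 0, 0, -1, 0, 0, 0, 0;
     0, 0, 1, 0, 0, 0, 0, 0;
     0, -1, 0, 0, 0, 0, 0, 0;
     1, 0, 0, 0, 0, 0, 0, 0]

/-- `P Pᵀ = 1`: the base change `kosinskiGamma8ToE₈` is a signed permutation matrix, hence
orthogonal over `ℤ`. [folklore] -/
theorem kosinskiGamma8ToE₈_mul_transpose : kosinskiGamma8ToE₈ * kosinskiGamma8ToE₈ᵀ = 1 := by
  decide

/-- `Pᵀ P = 1`: the base change `kosinskiGamma8ToE₈` is a signed permutation matrix, hence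
orthogonal over `ℤ`. [folklore] -/
theorem kosinskiGamma8ToE₈_transpose_mul : kosinskiGamma8ToE₈ᵀ * kosinskiGamma8ToE₈ = 1 := by
  decide

/-- **`Pᵀ E₈ P = Γ₈`**: Kosinski's `Γ₈` (VI.12, p. 122) is the Gram matrix of the `E₈` lattice
(Gram matrix `CartanMatrix.E₈` in Bourbaki's basis) in the basis `P eᵢ` — "renumber, and change
the signs of the basis vectors in one class of the bipartition of the tree". Checked by `decide`.
[cite: Kosinski1993, VI.12, p. 122 (the matrix Γ₈)] -/
theorem transpose_kosinskiGamma8ToE₈_mul_E₈_mul :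
    kosinskiGamma8ToE₈ᵀ * CartanMatrix.E₈ * kosinskiGamma8ToE₈ = kosinskiGamma8 := by
  decide

/-- The base change `P = kosinskiGamma8ToE₈` as a `ℤ`-linear automorphism of `ℤ⁸`
(inverse `Pᵀ`). [folklore] -/
def kosinskiGamma8Equiv : (Fin 8 → ℤ) ≃ₗ[ℤ] (Fin 8 → ℤ) :=
  LinearEquiv.ofLinear (Matrix.toLin' kosinskiGamma8ToE₈) (Matrix.toLin' kosinskiGamma8ToE₈ᵀ)
    (by rw [← Matrix.toLin'_mul, kosinskiGamma8ToE₈_mul_transpose, Matrix.toLin'_one])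
    (by rw [← Matrix.toLin'_mul, kosinskiGamma8ToE₈_transpose_mul, Matrix.toLin'_one])

/-- `kosinskiGamma8Equiv` acts as multiplication by the matrix `P`. [folklore] -/
@[simp] theorem kosinskiGamma8Equiv_apply (x : Fin 8 → ℤ) :
    kosinskiGamma8Equiv x = Matrix.toLin' kosinskiGamma8ToE₈ x := rfl

/-- The base change is an isometry from `(ℤ⁸, Γ₈)` to `(ℤ⁸, E₈)`:
`E₈ (P x, P y) = Γ₈ (x, y)` (from `Pᵀ E₈ P = Γ₈` and `Matrix.toBilin'_comp`).
[cite: Kosinski1993, VI.12, p. 122 (the matrix Γ₈)] -/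
theorem e8Form_kosinskiGamma8Equiv_apply (x y : Fin 8 → ℤ) :
    e8Form (kosinskiGamma8Equiv x) (kosinskiGamma8Equiv y) = Matrix.toBilin' kosinskiGamma8 x y := by
  rw [kosinskiGamma8Equiv_apply, kosinskiGamma8Equiv_apply, e8Form,
    ← LinearMap.BilinForm.comp_apply, Matrix.toBilin'_comp, transpose_kosinskiGamma8ToE₈_mul_E₈_mul]

/-- **"Intersection matrix `Γ₈`" means "intersection form isometric to `e8Form`"**: the bilinear
form on `ℤ⁸` with Gram matrix Kosinski's `Γ₈` (VI.12, p. 122) is isometric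
(`LinearMap.BilinForm.Equivalent`) to the tree's `E₈` form `Literature.Topology.FourManifolds.e8Form`
(Gram matrix `CartanMatrix.E₈`): the two are Gram matrices of one lattice in two bases related by
the signed permutation `kosinskiGamma8ToE₈`. This is the algebraic half of the rendering of
"`M(4n)` has the intersection matrix `Γ₈`" in
`HomotopySphere.exists_intersectionForm_equivalent_e8Form`; Milnor–Husemoller 1973, II §6 (the
`E₈` lattice). [cite: Kosinski1993, VI.12, p. 122 (the matrix Γ₈)] -/
theorem equivalent_toBilin'_kosinskiGamma8_e8Form :
    (Matrix.toBilin' kosinskiGamma8).Equivalent e8Form :=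
  ⟨{ kosinskiGamma8Equiv with
      map_app' := fun x y => e8Form_kosinskiGamma8Equiv_apply x y }⟩

/-- **`Γ₈` has signature `8`** (Kosinski 1993, VI.12, p. 122: "A calculation shows that the
quadratic form over the reals with the matrix `Γ₈` has signature `8`"): from the isometry with
`e8Form` and the tree theorem `signature_e8Form_holds` (`σ(E₈) = 8`, Serre V §1.4.3).
[cite: Kosinski1993, VI.12, p. 122] -/
theorem signature_toBilin'_kosinskiGamma8 : (Matrix.toBilin' kosinskiGamma8).signature = 8 := by
  rw [signature_eq_of_equivalent equivalent_toBilin'_kosinskiGamma8_e8Form]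
  exact signature_e8Form_holds

/-- **`Γ₈` is unimodular** (Kosinski 1993, VI.12, p. 122: "Since `Γ₈` is unimodular, `∂M(4n)` is
a homotopy sphere" — only the premise is recorded here): from the isometry with `e8Form` and the
tree theorem `isUnimodular_e8Form_holds` (`det E₈ = 1`). [cite: Kosinski1993, VI.12, p. 122] -/
theorem isUnimodular_toBilin'_kosinskiGamma8 : (Matrix.toBilin' kosinskiGamma8).IsUnimodular :=
  isUnimodular_of_equivalent equivalent_toBilin'_kosinskiGamma8_e8Form.symm isUnimodular_e8Form_holds

/-- **`Γ₈` is even** (diagonal entries `2`; Kosinski 1993, X.(3.1): the intersection pairing of a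
`π`-manifold `M²ᵏ`, `k` even, is even — here just the matrix fact), from the isometry with
`e8Form` and `isEven_e8Form`. [cite: Kosinski1993, VI.12, p. 122] -/
theorem isEven_toBilin'_kosinskiGamma8 : (Matrix.toBilin' kosinskiGamma8).IsEven :=
  (isEven_iff_of_equivalent equivalent_toBilin'_kosinskiGamma8_e8Form).2 isEven_e8Form

end Literature.Topology.FourManifolds
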